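import Literature.NumberTheory.EllipticCurves.ManinSymbolsWeightKGamma1Periods
import Mathlib.LinearAlgebra.Dual.Lemmas
import Mathlib.Algebra.Polynomial.Roots
import HarnessLib

/-!
# Manin–Drinfeld above `∞` for `S_{n+2}(Γ₁(N))`, `n ≥ 1`, by pure algebra: every period functional
# over `Γ₀(N)` is a `ℚ`-combination of diamond translates of period functionals over `Γ₁(N)`

A proofs-only file (theorems only; no definition, no named fact; D-0026), continuing
`EichlerShimuraPeriodsGamma1` (the period lattice `Λ = periodLatticeK1 n ⊆ S_{n+2}(Γ₁(N))^∨`,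
generated by the functionals `λ_{σ,q} : f ↦ c_f(σ)(q) = ∫_∞^{σ∞} f(z)((σq)₁z - (σq)₀)ⁿ dz` over
**all `σ ∈ Γ₀(N)`**) and `ManinSymbolsWeightKGamma1Periods` (Manin's trick and the crude count
`12 rank Λ ≤ (n+1)[SL(2,ℤ):Γ₁(N)]`).

For `σ ∈ Γ₀(N) ∖ Γ₁(N)` the functional `λ_{σ,q}` is the integral along a path joining the two
*distinct* cusps `∞` and `σ∞ = ⟨d⟩∞` of `X₁(N)` (a cusp "above `∞`"), i.e. a non-cuspidal modular
symbol; that such symbols lie in the `ℚ`-span of the cuspidal ones is the Manin–Drinfeld theorem,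
classically proved with Hecke operators `T_ℓ`, `ℓ ≡ 1 (N)`, and the separation of the Eisenstein
eigenvalue `1 + ℓ^{n+1}` from the cuspidal spectrum (Drinfeld 1973; Manin 1972, Thm. 3.3 for weight
`2`).  **In weight `n + 2 ≥ 3` the passage from the cusps above `∞` to the cusp `∞` alone is a
formal consequence of the cocycle relation** — every `λ_{σ,q}` is a `ℚ`-combination of diamond
translates of the loop functionals `λ_{γ,q}`, `γ ∈ Γ₁(N)` — which is what this file proves (the
loops through `∞` are themselves not cuspidal symbols in weight `> 2`; see *Scope* below):

* `periodFunctionalK1_act_sub_mem_span` — for `σ ∈ Γ₀(N)`, `γ ∈ Γ₁(N)` and `γ' = σγσ⁻¹ ∈ Γ₁(N)`,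
  the two cocycle identities `⟨σ⟩^∨ λ_{γ,q} = λ_{σγ,q} - λ_{σ,γq}` and
  `λ_{σ,q} = ⟨γ'⟩^∨λ_{σ,q} = λ_{γ'σ,q} - λ_{γ',σq}` (`dualMap_diamondOp_periodFunctionalK1`,
  `⟨γ'⟩ = 1`) give, since `σγ = γ'σ`,

    `λ_{σ,γq} - λ_{σ,q} = λ_{γ',σq} - ⟨σ⟩^∨ λ_{γ,q} ∈ C`,

  where `C` is the `ℚ`-span of the diamond translates `⟨d⟩^∨ λ_{γ,q}`, `γ ∈ Γ₁(N)` (loops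
  `∞ → γ∞` through the cusp `∞`);
* `polyFun_eq_zero_of_forall_gamma1` — **a homogeneous polynomial function of degree `n ≥ 1` on `ℤ²`
  invariant under `Γ₁(N)` vanishes** (`Tʷ`-invariance at `(0,1)` makes `∑ⱼ cⱼ wʲ` constant in
  `w ∈ ℤ`, so `c_j = 0` for `j ≥ 1`; then `(1 0; N 1)` at `(1, 0)` gives `c₀Nⁿ = 0`);
* `periodFunctionalK1_mem_span_closed` — hence **`λ_{σ,q} ∈ C` for every `σ ∈ Γ₀(N)`**: otherwise a
  `ℚ`-linear functional `ℓ` killing `C` with `ℓ(λ_{σ,q}) ≠ 0` would make `q ↦ ℓ(λ_{σ,q})` a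
  non-zero `Γ₁(N)`-invariant element of `W_n` (it is polynomial of degree `n` in `q`,
  `pathFnl_isPolyE`);
* **`span_periodLatticeK1_eq_span_closed`**: `ℚΛ = C` (`n ≥ 1`, every level `N ≥ 1`), and the
  same with the generators written as `⟨d⟩^∨ (pathFnl n γ q)`, `γ ∈ Γ₁(N)`
  (`span_periodLatticeK1_eq_span_pathFnl`).

**Scope (what this does and does not remove).**  The theorem reduces the cusps entering the
rank count of `Λ` from all the cusps above `∞` to the single cusp `∞`: `ℚΛ` is spanned by the
diamond translates of the functionals of the loops `∞ → γ∞`, `γ ∈ Γ₁(N)`.  In weight `n + 2 ≥ 3`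
these loops are **not** boundary-free Manin-symbol chains: the chain of `λ_{γ,q}` has boundary
`(q₁ⁿ - (cq₀ + dq₁)ⁿ)[∞]` (`γ = (a b; c d)`), non-zero for `c ≠ 0`, because `Γ_∞ = ⟨T⟩` has only
one-dimensional coinvariants on `V_n`.  So the bound `rank Λ ≤ 2 dim_ℂ S_{n+2}(Γ₁(N))`
(Shimura 1971, Thm. 8.4; the input of `heckeStableRealLatticeOfGenerators` and
`prop55_of_periodLatticeK1_eq_span_of_five_le`) still needs, besides the boundary map on the
weight-`(n+2)` Manin symbols of `Γ₁(N)`, the Manin–Drinfeld step **at the cusp `∞` itself** — that a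
chain with boundary `[∞]` has its period functional in the `ℚ`-span of those of the boundary-free
chains — for which the classical tool is a Hecke operator `T_ℓ`, `ℓ ≡ 1 (N)`, acting on the boundary
line of `∞` by `1 + ℓ^{n+1}`, a number that is not an eigenvalue of `T_ℓ` on `S_{n+2}(Γ₁(N))`
(`HeckeEigenvalueSupNormBoundProofs.norm_lt_one_add_pow_of_heckeT_gamma1_eq_smul`,
`ker_heckeT_gamma1_sub_eq_bot`).  What the present file removes is only the need to treat the other
cusps above `∞` (and the diamond twists) in that step.  (For `n = 0` the lemma on invariant
polynomials fails — constants are invariant — and already the reduction proved here is a genuinely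
arithmetic statement, Manin–Drinfeld in weight `2`.)

## References

* V. G. Drinfeld, *Two theorems on modular curves*, Funct. Anal. Appl. 7 (1973), 155–156.
* Ju. I. Manin, *Parabolic points and zeta functions of modular curves*, Izv. Akad. Nauk SSSR 36
  (1972), 19–66, Thm. 3.3 and §1.
* G. Shimura, *Introduction to the arithmetic theory of automorphic functions* (1971), §8.2
  (the cocycle relation (8.2.2)), Thm. 8.4.
* L. Merel, *Universal Fourier expansions of modular forms*, LNM 1585 (1994), §1.2–1.3.
-/

noncomputable section

namespace Literature.NumberTheory.EllipticCurves.ModularForms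

namespace ManinK

open Module Matrix.SpecialLinearGroup ModularGroup CongruenceSubgroup
open scoped MatrixGroups ModularForm

/-! ### Invariant homogeneous polynomial functions on `ℤ²` vanish (`n ≥ 1`) -/

section Invariant

variable {N : ℕ} [NeZero N] {n : ℕ}

/-- The lower unipotent `(1 0; N 1) ∈ SL(2, ℤ)`. [folklore] -/
theorem exists_lower_mem_gamma1 (N : ℕ) :
    ∃ L : SL(2, ℤ), L ∈ Gamma1 N ∧ L 0 0 = 1 ∧ L 0 1 = 0 ∧ L 1 0 = N ∧ L 1 1 = 1 := by
  refine ⟨⟨!![1, 0; (N : ℤ), 1], by norm_num [Matrix.det_fin_two_of]⟩, ?_, rfl, rfl, rfl, rfl⟩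
  rw [Gamma1_mem]
  simp

/-- **A `Γ₁(N)`-invariant homogeneous polynomial function of degree `n ≥ 1` on `ℤ²` vanishes**
(`W_n^{Γ₁(N)} = 0`; the coinvariant form of `V_n^Γ = 0`, `dual_eq_zero_of_invariant`).
Write `φ = ∑ⱼ cⱼ q₀ʲq₁ⁿ⁻ʲ`.  Invariance under `Tʷ = (1 w; 0 1)` at `q = (0, 1)` gives
`∑ⱼ cⱼ wʲ = c₀` for every `w ∈ ℤ`, so the polynomial `∑_{j ≥ 1} cⱼ Xʲ` has infinitely many roots and
`cⱼ = 0` for `j ≥ 1`; then `φ(q) = c₀ q₁ⁿ`, and invariance under `(1 0; N 1)` at `(1, 0)` gives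
`c₀ Nⁿ = c₀ 0ⁿ = 0`. [folklore] -/
theorem polyFun_eq_zero_of_forall_gamma1 (hn : 1 ≤ n) {φ : (Fin 2 → ℤ) → ℚ}
    (hφ : φ ∈ polyFun n) (hinv : ∀ γ ∈ Gamma1 N, ∀ q, φ (act γ q) = φ q) : φ = 0 := by
  classical
  obtain ⟨c, hc⟩ := (Submodule.mem_span_range_iff_exists_fun (R := ℚ)).mp hφ
  -- values on the line `q₁ = 1`
  have hval : ∀ w : ℤ, φ ![w, 1] = ∑ i : Fin (n + 1), c i * (w : ℚ) ^ (i : ℕ) := fun w ↦ by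
    rw [← hc, Finset.sum_apply]
    refine Finset.sum_congr rfl fun i _ ↦ ?_
    simp [mono_apply]
  -- `Tʷ`-invariance at `(0, 1)`
  have hT : ∀ w : ℤ, φ ![w, 1] = φ ![0, 1] := fun w ↦ by
    have h := hinv (T ^ w) (HeckeTGamma1.T_zpow_mem_Gamma1 N w) ![0, 1]
    have hact : act (T ^ w) ![0, 1] = ![w, 1] := by
      funext i
      fin_cases i <;> simp [act_apply_zero, act_apply_one, ModularGroup.coe_T_zpow]
    rw [hact] at h
    exact h
  -- the polynomial `P = ∑ cᵢ Xⁱ` is constant on `ℤ`, hence `cᵢ = 0` for `i ≥ 1`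
  set P : Polynomial ℚ := ∑ i : Fin (n + 1), Polynomial.C (c i) * Polynomial.X ^ (i : ℕ) with hP
  have hPeval : ∀ w : ℤ, P.eval (w : ℚ) = φ ![w, 1] := fun w ↦ by
    rw [hval, hP, Polynomial.eval_finsetSum]
    simp [Polynomial.eval_mul, Polynomial.eval_C, Polynomial.eval_pow, Polynomial.eval_X]
  have hQ : P - Polynomial.C (φ ![0, 1]) = 0 := by
    apply Polynomial.eq_zero_of_infinite_isRoot
    refine Set.Infinite.mono (s := Set.range (Int.cast : ℤ → ℚ)) ?_
      (Set.infinite_range_of_injective Int.cast_injective)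
    rintro _ ⟨w, rfl⟩
    simp only [Set.mem_setOf_eq, Polynomial.IsRoot.def, Polynomial.eval_sub, Polynomial.eval_C,
      hPeval, hT w, sub_self]
  have hcoeff : ∀ i : Fin (n + 1), 1 ≤ (i : ℕ) → c i = 0 := by
    intro i hi
    have h1 : P.coeff i = c i := by
      rw [hP, Polynomial.finsetSum_coeff]
      simp only [Polynomial.coeff_C_mul, Polynomial.coeff_X_pow]
      rw [Finset.sum_eq_single i (fun j _ hj ↦ by
        rw [if_neg (fun h ↦ hj (Fin.ext h.symm)), mul_zero]) (fun h ↦ absurd (Finset.mem_univ i) h)]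
      simp
    have h2 : P.coeff i = (Polynomial.C (φ ![0, 1])).coeff i := by rw [← sub_eq_zero.mp hQ]
    rw [h1, Polynomial.coeff_C, if_neg (by omega)] at h2
    exact h2
  -- hence `φ q = c₀ q₁ⁿ`
  have hφq : ∀ q, φ q = c 0 * (q 1 : ℚ) ^ n := fun q ↦ by
    rw [← hc, Finset.sum_apply, Finset.sum_eq_single (0 : Fin (n + 1))
      (fun i _ hi ↦ by
        rw [Pi.smul_apply, hcoeff i (Nat.one_le_iff_ne_zero.mpr fun h ↦ hi (Fin.ext h)), zero_smul])
      (fun h ↦ absurd (Finset.mem_univ _) h)]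
    simp [mono_apply]
  -- invariance under `(1 0; N 1)` at `(1, 0)`: `c₀ Nⁿ = 0`
  obtain ⟨L, hL, hL00, hL01, hL10, hL11⟩ := exists_lower_mem_gamma1 N
  have h := hinv L hL ![1, 0]
  have hact : act L ![1, 0] = ![1, (N : ℤ)] := by
    funext i
    fin_cases i <;> simp [act_apply_zero, act_apply_one, hL00, hL01, hL10, hL11]
  rw [hact, hφq, hφq] at h
  simp only [Matrix.cons_val_one, Matrix.cons_val_fin_one, Int.cast_natCast, Int.cast_zero,
    zero_pow (by omega : n ≠ 0), mul_zero, mul_eq_zero, pow_eq_zero_iff (by omega : n ≠ 0),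
    Nat.cast_eq_zero, NeZero.ne N, or_false] at h
  funext q
  rw [hφq, h, zero_mul, Pi.zero_apply]

end Invariant

/-! ### The cocycle relation: `λ_{σ,γq} - λ_{σ,q}` is a combination of loops through `∞` -/

section Closed

variable {N : ℕ} [NeZero N] (n : ℕ)

/-- `⟨γ⟩ = 1` on `S_k(Γ₁(N))` for `γ ∈ Γ₀(N)` with lower-right entry `≡ 1`, i.e. `γ ∈ Γ₁(N)`.
[folklore] -/
theorem dualMap_diamondOp_eq_self_of_eq_one {k : ℤ} {γ : Gamma0 N} (hγ : Gamma0Map N γ = 1)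
    (φ : Module.Dual ℂ (CuspForm (Gamma1 N) k)) :
    (diamondOp N k (Gamma0Map N γ)).dualMap φ = φ := by
  rw [hγ, diamondOp_one_eq_id, LinearMap.dualMap_id, LinearMap.id_apply]

omit [NeZero N] in
/-- `Γ₁(N)`-membership of an element of `Γ₀(N)` is `Gamma0Map = 1`. [folklore] -/
theorem gamma0Map_eq_one_iff (γ : Gamma0 N) : Gamma0Map N γ = 1 ↔ (γ : SL(2, ℤ)) ∈ Gamma1 N := by
  rw [← Gamma1_mem', Gamma1_to_Gamma0_mem, Gamma1_mem]

omit [NeZero N] in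
/-- `Γ₁(N)` is normal in `Γ₀(N)`: `Gamma0Map (σγσ⁻¹) = Gamma0Map γ`. [folklore] -/
theorem gamma0Map_conj (σ γ : Gamma0 N) : Gamma0Map N (σ * γ * σ⁻¹) = Gamma0Map N γ := by
  rw [map_mul, map_mul, mul_comm (Gamma0Map N σ), mul_assoc, ← map_mul, mul_inv_cancel, map_one,
    mul_one]

/-- **The key relation.** For `σ ∈ Γ₀(N)`, `γ ∈ Γ₁(N)` (i.e. `Gamma0Map γ = 1`) and `q ∈ ℤ²`:
`λ_{σ,γq} - λ_{σ,q} = λ_{γ',σq} - ⟨σ⟩^∨ λ_{γ,q}` with `γ' = σγσ⁻¹ ∈ Γ₁(N)` — two instances of the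
cocycle relation `⟨x⟩^∨ λ_{y,q} = λ_{xy,q} - λ_{x,yq}` (`dualMap_diamondOp_periodFunctionalK1`), for
`(x, y) = (σ, γ)` and `(γ', σ)`, using `σγ = γ'σ` and `⟨γ'⟩ = 1`.
[cite: Shimura1971, §8.2 (8.2.2)] -/
theorem periodFunctionalK1_act_sub_eq (σ γ : Gamma0 N) (hγ : Gamma0Map N γ = 1) (q : Fin 2 → ℤ) :
    periodFunctionalK1 n σ (act γ q) - periodFunctionalK1 n σ q =
      periodFunctionalK1 n (σ * γ * σ⁻¹) (act σ q) -
        (diamondOp N (n + 2) (Gamma0Map N σ)).dualMap (periodFunctionalK1 n γ q) := by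
  have hα := dualMap_diamondOp_periodFunctionalK1 (n := n) σ γ q
  have hβ := dualMap_diamondOp_periodFunctionalK1 (n := n) (σ * γ * σ⁻¹) σ q
  rw [dualMap_diamondOp_eq_self_of_eq_one (by rw [gamma0Map_conj, hγ])] at hβ
  have hprod : σ * γ * σ⁻¹ * σ = σ * γ := by group
  rw [hprod] at hβ
  change periodFunctionalK1 n σ (((γ : SL(2, ℤ)) : Matrix (Fin 2) (Fin 2) ℤ).mulVec q) -
      periodFunctionalK1 n σ q =
    periodFunctionalK1 n (σ * γ * σ⁻¹) (((σ : SL(2, ℤ)) : Matrix (Fin 2) (Fin 2) ℤ).mulVec q) - _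
  rw [hα, hβ]
  abel

/-- The `ℚ`-span of the diamond translates `⟨d⟩^∨ λ_{γ,q}` of the period functionals over
`Γ₁(N)` (loops `∞ → γ∞` through the cusp `∞`) contains every difference `λ_{σ,γq} - λ_{σ,q}`,
`σ ∈ Γ₀(N)`, `γ ∈ Γ₁(N)`. [cite: Shimura1971, §8.2 (8.2.2)] -/
theorem periodFunctionalK1_act_sub_mem_span (σ γ : Gamma0 N) (hγ : Gamma0Map N γ = 1)
    (q : Fin 2 → ℤ) :
    periodFunctionalK1 n σ (act γ q) - periodFunctionalK1 n σ q ∈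
      Submodule.span ℚ {φ : Module.Dual ℂ (CuspForm (Gamma1 N) (n + 2)) |
        ∃ (d : ZMod N) (γ₁ : Gamma0 N) (q₁ : Fin 2 → ℤ), Gamma0Map N γ₁ = 1 ∧
          φ = (diamondOp N (n + 2) d).dualMap (periodFunctionalK1 n γ₁ q₁)} := by
  rw [periodFunctionalK1_act_sub_eq n σ γ hγ q]
  refine sub_mem (Submodule.subset_span ⟨1, σ * γ * σ⁻¹, act σ q, by rw [gamma0Map_conj, hγ], ?_⟩)
    (Submodule.subset_span ⟨Gamma0Map N σ, γ, q, hγ, rfl⟩)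
  rw [diamondOp_one_eq_id, LinearMap.dualMap_id, LinearMap.id_apply]

/-! ### Every period functional over `Γ₀(N)` lies in the span of the loops through `∞` -/

/-- **Manin–Drinfeld above `∞`, algebraic form** (`n ≥ 1`, every `N ≥ 1`): for every `σ ∈ Γ₀(N)`
and `q ∈ ℤ²` the period functional `λ_{σ,q}` (a path from `∞` to the cusp `σ∞` above `∞`) is a
`ℚ`-combination of diamond translates `⟨d⟩^∨ λ_{γ,q'}` of period functionals over `Γ₁(N)` (loops
`∞ → γ∞` through the cusp `∞`; in weight `> 2` their chains still carry a boundary at `∞`, see the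
module docstring).  Proof: if not, a `ℚ`-linear functional `ℓ` vanishing on their span `C` with
`ℓ(λ_{σ,q}) ≠ 0` exists (`Submodule.exists_dual_map_eq_bot_of_notMem`); `q' ↦ ℓ(λ_{σ,q'})` is a
homogeneous polynomial function of degree `n` (`pathFnl_isPolyE`), `Γ₁(N)`-invariant by
`periodFunctionalK1_act_sub_mem_span`, hence zero (`polyFun_eq_zero_of_forall_gamma1`).
[cite: Shimura1971, Thm. 8.4 and §8.2] -/
theorem periodFunctionalK1_mem_span_closed (hn : 1 ≤ n) (σ : Gamma0 N) (q : Fin 2 → ℤ) :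
    periodFunctionalK1 n σ q ∈
      Submodule.span ℚ {φ : Module.Dual ℂ (CuspForm (Gamma1 N) (n + 2)) |
        ∃ (d : ZMod N) (γ₁ : Gamma0 N) (q₁ : Fin 2 → ℤ), Gamma0Map N γ₁ = 1 ∧
          φ = (diamondOp N (n + 2) d).dualMap (periodFunctionalK1 n γ₁ q₁)} := by
  set C := Submodule.span ℚ {φ : Module.Dual ℂ (CuspForm (Gamma1 N) (n + 2)) |
        ∃ (d : ZMod N) (γ₁ : Gamma0 N) (q₁ : Fin 2 → ℤ), Gamma0Map N γ₁ = 1 ∧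
          φ = (diamondOp N (n + 2) d).dualMap (periodFunctionalK1 n γ₁ q₁)} with hC
  by_contra hnot
  obtain ⟨ℓ, hℓ, hℓC⟩ := Submodule.exists_dual_map_eq_bot_of_notMem hnot inferInstance
  have hker : ∀ φ ∈ C, ℓ φ = 0 := fun φ hφ ↦
    LinearMap.mem_ker.mp (LinearMap.le_ker_iff_map.mpr hℓC hφ)
  -- the polynomial function `q' ↦ ℓ(λ_{σ,q'})`
  set ψ : (Fin 2 → ℤ) → ℚ := fun q' ↦ ℓ (periodFunctionalK1 n σ q') with hψ
  have hψmem : ψ ∈ polyFun n := by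
    obtain ⟨μ, hμ⟩ := pathFnl_isPolyE (N := N) n (σ : SL(2, ℤ))
    have heq : ψ = ∑ j ∈ Finset.range (n + 1), ℓ (μ j) • mono n j := by
      funext q'
      rw [hψ]
      simp only [periodFunctionalK1_eq_pathFnl, hμ q', map_sum, map_smul, smul_eq_mul,
        Finset.sum_apply, Pi.smul_apply]
      exact Finset.sum_congr rfl fun j _ ↦ mul_comm _ _
    rw [heq]
    exact Submodule.sum_mem _ fun j hj ↦
      Submodule.smul_mem _ _ (mono_mem (Nat.lt_succ_iff.mp (Finset.mem_range.mp hj)))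
  have hψinv : ∀ γ ∈ Gamma1 N, ∀ q', ψ (act γ q') = ψ q' := by
    intro γ hγ q'
    have hγ0 : γ ∈ Gamma0 N := Gamma1_in_Gamma0 N hγ
    have h1 : Gamma0Map N ⟨γ, hγ0⟩ = 1 := (gamma0Map_eq_one_iff ⟨γ, hγ0⟩).mpr hγ
    have h := hker _ (periodFunctionalK1_act_sub_mem_span n σ ⟨γ, hγ0⟩ h1 q')
    rw [map_sub, sub_eq_zero] at h
    exact h
  have h0 := polyFun_eq_zero_of_forall_gamma1 (N := N) hn hψmem hψinv
  exact hℓ (by simpa [hψ] using congr_fun h0 q)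

/-- **`ℚΛ = C`**: the `ℚ`-span of the Eichler–Shimura period lattice `periodLatticeK1 n` of
`S_{n+2}(Γ₁(N))` (`n ≥ 1`) equals the `ℚ`-span of the diamond translates `⟨d⟩^∨ λ_{γ,q}` of the
period functionals over `Γ₁(N)` (`Gamma0Map γ = 1`). [cite: Shimura1971, Thm. 8.4 and §8.2] -/
theorem span_periodLatticeK1_eq_span_closed (hn : 1 ≤ n) :
    Submodule.span ℚ (periodLatticeK1 (N := N) n :
        Set (Module.Dual ℂ (CuspForm (Gamma1 N) (n + 2)))) =
      Submodule.span ℚ {φ : Module.Dual ℂ (CuspForm (Gamma1 N) (n + 2)) |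
        ∃ (d : ZMod N) (γ₁ : Gamma0 N) (q₁ : Fin 2 → ℤ), Gamma0Map N γ₁ = 1 ∧
          φ = (diamondOp N (n + 2) d).dualMap (periodFunctionalK1 n γ₁ q₁)} := by
  refine le_antisymm (Submodule.span_le.mpr fun φ hφ ↦ ?_) (Submodule.span_le.mpr ?_)
  · induction hφ using AddSubgroup.closure_induction with
    | mem x hx =>
      obtain ⟨⟨σ, q⟩, rfl⟩ := hx
      exact periodFunctionalK1_mem_span_closed n hn σ q
    | zero => exact Submodule.zero_mem _
    | add x y _ _ hx hy => exact Submodule.add_mem _ hx hy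
    | neg x _ hx => exact Submodule.neg_mem _ hx
  · rintro _ ⟨d, γ₁, q₁, -, rfl⟩
    exact Submodule.subset_span
      (dualMap_diamondOp_mem_periodLatticeK1 d (periodFunctionalK1_mem γ₁ q₁))

/-- The same with the generators written as `⟨d⟩^∨ (pathFnl n γ q)`, `γ ∈ Γ₁(N)` (the functionals
of the loops `∞ → γ∞` through `∞` and their diamond translates).
[cite: Shimura1971, Thm. 8.4 and §8.2] -/
theorem span_periodLatticeK1_eq_span_pathFnl (hn : 1 ≤ n) :
    Submodule.span ℚ (periodLatticeK1 (N := N) n :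
        Set (Module.Dual ℂ (CuspForm (Gamma1 N) (n + 2)))) =
      Submodule.span ℚ {φ : Module.Dual ℂ (CuspForm (Gamma1 N) (n + 2)) |
        ∃ (d : ZMod N) (γ : SL(2, ℤ)) (q : Fin 2 → ℤ), γ ∈ Gamma1 N ∧
          φ = (diamondOp N (n + 2) d).dualMap (pathFnl n γ q)} := by
  rw [span_periodLatticeK1_eq_span_closed n hn]
  congr 1
  ext φ
  constructor
  · rintro ⟨d, γ₁, q₁, h1, rfl⟩
    exact ⟨d, γ₁, q₁, (gamma0Map_eq_one_iff γ₁).mp h1, rfl⟩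
  · rintro ⟨d, γ, q, hγ, rfl⟩
    exact ⟨d, ⟨γ, Gamma1_in_Gamma0 N hγ⟩, q, (gamma0Map_eq_one_iff ⟨γ, _⟩).mpr hγ, rfl⟩

/-- **Every period functional is a `ℚ`-combination of closed-path functionals and their diamond
translates**, membership form for `λ_{σ,q} = pathFnl n σ q`, `σ ∈ Γ₀(N)`.
[cite: Shimura1971, Thm. 8.4 and §8.2] -/
theorem pathFnl_mem_span_closed (hn : 1 ≤ n) {σ : SL(2, ℤ)} (hσ : σ ∈ Gamma0 N) (q : Fin 2 → ℤ) :
    pathFnl (N := N) n σ q ∈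
      Submodule.span ℚ {φ : Module.Dual ℂ (CuspForm (Gamma1 N) (n + 2)) |
        ∃ (d : ZMod N) (γ : SL(2, ℤ)) (q : Fin 2 → ℤ), γ ∈ Gamma1 N ∧
          φ = (diamondOp N (n + 2) d).dualMap (pathFnl n γ q)} := by
  rw [← span_periodLatticeK1_eq_span_pathFnl n hn]
  exact Submodule.subset_span (periodFunctionalK1_mem ⟨σ, hσ⟩ q)

end Closed

end ManinK

end Literature.NumberTheory.EllipticCurves.ModularForms
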